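import Summits.AtomisticToContinuum.BoseEinsteinCondensation.Theorems.LatticeODLROOffHalfFilling.Negative.OffHalfFillingForced

/-!
# Crux `LatticeODLROOffHalfFilling` — the grand-canonical ground energy is maximal at half filling

Crux-disprover support for `stmt-AtomisticToContinuum-11033` (route BECGroundStateSOS), part 5d
(needs 5c `OffHalfFillingForced`): `groundEnergy_hmu_le_zero : E₀(H_{L,μ}) ≤ E₀(H_{L,0})` for
every real `μ` and `L ≥ 3` — a nonzero column `ψ` of `P₀(H_{L,0})` is an `S³_tot`-eigenvector
(`S³ψ = Mψ`) and `ψ` or its flip `Uψ` has energy `E₀(0) − |μM|` at chemical potential `μ`.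
This is the input for the `μ`-deformed bond-energy bound (D_μ) of the route's planned
`LatticeKLSAssemblyMu`: `ω_μ(H_XY) = E₀(μ) + μ ω_μ(S³_tot) ≤ E₀(0) + |μ||Λ|/2`. [folklore]
-/

noncomputable section

namespace Summit.AtomisticToContinuum.BoseEinsteinCondensation.Theorems.LatticeODLROOffHalfFilling.Negative

open Literature.MathematicalPhysics.QuantumLattice Literature.Probability.LatticeModels Matrix Finset
open scoped ComplexOrder BigOperators

section OffHalf

variable (L : ℕ) [NeZero L]

/-- **The grand-canonical ground energy is maximal at half filling**: `E₀(H_{L,μ}) ≤ E₀(H_{L,0})`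
for every `μ` (`L ≥ 3`). A nonzero column `ψ` of `P₀(H_{L,0})` is an `S³_tot`-eigenvector
(`S³ψ = Mψ`); `ψ` (if `μM ≥ 0`) or its flip `Uψ` (if `μM ≤ 0`) has energy `E₀(0) − |μM| ≤ E₀(0)`
at chemical potential `μ`. (Input for the provers' `μ`-deformed bond-energy bound (D_μ):
`ω_μ(H_XY) = E₀(μ) + μ ω_μ(S³_tot) ≤ E₀(0) + |μ||Λ|/2`.) [folklore] -/
theorem groundEnergy_hmu_le_zero (hL : 3 ≤ L) (μ : ℝ) :
    (Hmu L μ).groundEnergy ≤ (Hmu L 0).groundEnergy := by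
  set H₀ : Op (TorusSite 3 L) 2 := Hmu L 0 with hH₀
  set Hμ : Op (TorusSite 3 L) 2 := Hmu L μ with hHμ
  set S3 : Op (TorusSite 3 L) 2 := totalSpin 1 2 with hS3
  have hH₀h : H₀.IsHermitian := Hmu_isHermitian L 0
  have hHμh : Hμ.IsHermitian := Hmu_isHermitian L μ
  -- a nonzero column of P₀(H₀)
  obtain ⟨σ, hψ0⟩ : ∃ σ, H₀.groundProj.col σ ≠ 0 := by
    by_contra hall
    push Not at hall
    apply groundProj_ne_zero hH₀h
    ext a σ
    have := congrFun (hall σ) a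
    simpa [Matrix.col_apply] using this
  set ψ := H₀.groundProj.col σ with hψdef
  have hψmem : ψ ∈ H₀.groundSpace := groundProj_col_mem H₀ σ
  have hH₀ψ : H₀ *ᵥ ψ = (H₀.groundEnergy : ℂ) • ψ := (mem_groundSpace_iff H₀ ψ).mp hψmem
  have nψ : 0 < (star ψ ⬝ᵥ ψ).re := by
    have hnn : 0 ≤ (star ψ ⬝ᵥ ψ).re := (Complex.nonneg_iff.mp (dotProduct_star_self_nonneg ψ)).1
    rcases hnn.lt_or_eq with hlt | heq
    · exact hlt
    · exfalso
      apply hψ0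
      apply dotProduct_star_self_eq_zero.mp
      rw [star_dotProduct_self_eq_ofReal, ← heq]
      simp
  set M : ℝ := (Fintype.card (TorusSite 3 L) : ℝ) / 2 - (downCount σ : ℝ) with hM
  have hS3ψ : S3 *ᵥ ψ = (M : ℂ) • ψ := by
    have hc : S3 * H₀ = H₀ * S3 := (commute_hmu_totalSpin_two L hL 0).symm.eq
    have hP := groundProj_commute_of_commute hH₀h hc
    rw [hψdef, ← mulVec_single_one, mulVec_mulVec, ← hP, ← mulVec_mulVec, hS3,
      totalSpin_two_mulVec_single, mulVec_smul]
    congr 1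
    rw [hM]
    push_cast
    ring
  have hHμ_eq : ∀ φ : TensorIndex (TorusSite 3 L) 2 → ℂ,
      Hμ *ᵥ φ = H₀ *ᵥ φ - (μ : ℂ) • (S3 *ᵥ φ) := by
    intro φ
    rw [hHμ, hH₀, Hmu, Hmu, sub_mulVec, sub_mulVec, smul_mulVec, smul_mulVec, ← hS3,
      Complex.ofReal_zero, zero_smul, sub_zero]
  have ray : ∀ φ : TensorIndex (TorusSite 3 L) 2 → ℂ,
      Hμ.groundEnergy * (star φ ⬝ᵥ φ).re ≤ (star φ ⬝ᵥ Hμ *ᵥ φ).re := by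
    intro φ
    have h := (posSemidef_sub_of_groundEnergy_le hHμh (le_refl _)).dotProduct_mulVec_nonneg φ
    rw [sub_mulVec, smul_mulVec, one_mulVec, dotProduct_sub, dotProduct_smul, smul_eq_mul] at h
    obtain ⟨hre, -⟩ := Complex.nonneg_iff.mp h
    rw [Complex.sub_re, Complex.re_ofReal_mul] at hre
    linarith
  -- energies of ψ and of its flip φ
  have hray1 := ray ψ
  rw [hHμ_eq, dotProduct_sub, dotProduct_smul, smul_eq_mul, Complex.sub_re, Complex.re_ofReal_mul,
    hH₀ψ, dotProduct_smul, smul_eq_mul, Complex.re_ofReal_mul, hS3ψ, dotProduct_smul, smul_eq_mul,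
    Complex.re_ofReal_mul] at hray1
  set φ := (flipOp : Op (TorusSite 3 L) 2) *ᵥ ψ with hφ
  have hnφ : (star φ ⬝ᵥ φ).re = (star ψ ⬝ᵥ ψ).re := by
    rw [hφ, star_mulVec_dotProduct_mulVec flipOp_conjTranspose_mul]
  have hH₀φ : H₀ *ᵥ φ = (H₀.groundEnergy : ℂ) • φ := by
    have hcomm : flipOp * H₀ = H₀ * flipOp := by
      have := flipOp_mul_hmu L hL 0
      rwa [neg_zero] at this
    rw [hφ, mulVec_mulVec, ← hcomm, ← mulVec_mulVec, hH₀ψ, mulVec_smul]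
  have hS3φ : S3 *ᵥ φ = (-(M : ℂ)) • φ := by
    rw [hφ, mulVec_mulVec, hS3, totalSpin_two_mul_flipOp, Matrix.neg_mulVec, ← hS3,
      ← mulVec_mulVec, hS3ψ, mulVec_smul, neg_smul]
  have hray2 := ray φ
  rw [hHμ_eq, dotProduct_sub, dotProduct_smul, smul_eq_mul, Complex.sub_re, Complex.re_ofReal_mul,
    hH₀φ, dotProduct_smul, smul_eq_mul, Complex.re_ofReal_mul, hS3φ, dotProduct_smul, smul_eq_mul,
    ← Complex.ofReal_neg, Complex.re_ofReal_mul, hnφ] at hray2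
  -- hray1 : Eμ n ≤ E0 n − μ (M n) ; hray2 : Eμ n ≤ E0 n − μ (−M n)
  by_contra hcon
  push Not at hcon
  have h1 : (Hmu L 0).groundEnergy * (star ψ ⬝ᵥ ψ).re < Hμ.groundEnergy * (star ψ ⬝ᵥ ψ).re :=
    mul_lt_mul_of_pos_right hcon nψ
  rcases le_or_gt 0 (μ * M) with hMM | hMM
  · nlinarith [mul_nonneg hMM nψ.le]
  · nlinarith [mul_pos (neg_pos.mpr hMM) nψ]

end OffHalf

end Summit.AtomisticToContinuum.BoseEinsteinCondensation.Theorems.LatticeODLROOffHalfFilling.Negative
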